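import Mathlib
import HarnessLib

/-!
# Inclusion and exclusion radii for the zeros of a polynomial (Henrici §6.4; Fujiwara's bound)

`Literature/Algebra/Polynomial/InclusionRadius.lean`, namespace
`Literature.Algebra.Polynomial.InclusionRadius`. Everything here is PROVED (two definitions of
closed-form radii, no named facts).

For a polynomial `p = aₙ Xⁿ + … + a₁ X + a₀` (`aₙ = p.leadingCoeff ≠ 0`) over a normed field, the
classical *Cauchy-type* argument `|p(z)| ≥ |aₙ||z|ⁿ − Σ_{i<n} |aᵢ||z|ⁱ` gives discs about the origin
containing ALL zeros (an **inclusion radius**, Henrici §6.4.III) and, dually,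
`|p(z)| ≥ |a₀| − Σ_{m≥1} |a_m||z|^m` gives discs containing NO zero (Henrici §6.4.I). We formalise
P. Henrici, *Applied and Computational Complex Analysis* I (Wiley 1974), §6.4, in the
"certificate" form a validated root finder checks (given a candidate radius and weights, finitely
many coefficient inequalities) together with the closed-form radii:

* `norm_le_of_coeff_le` — **Theorem 6.4j** (weights `λ₁, …, λₙ ≥ 0`, `Σ λ_m ≤ 1`; if
  `|a_{n−m}| ≤ λ_m |aₙ| σ^m` for `m = 1, …, n` then every zero has `|w| ≤ σ`), and its *proper*
  version `norm_lt_of_coeff_le` (`Σ λ_m < 1`, `σ > 0` ⟹ `|w| < σ`); also Petković 2008 Thm 1.1;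
* `norm_le_of_sum_le` — **Theorem 6.4l** (Cauchy): `Σ_{i<n} |aᵢ| σⁱ ≤ |aₙ| σⁿ`, `σ > 0` ⟹ `|w| ≤ σ`;
* `inclusionRadius p = 2 · max_{1≤m≤n} |a_{n−m}/aₙ|^{1/m}` — **Corollary 6.4k** (= Petković 2008
  (1.58), Dekker, Knuth): `nnnorm_le_inclusionRadius`, and the proper form
  `nnnorm_lt_inclusionRadius` when `a₀ ≠ 0`; set form `setOf_isRoot_subset_closedBall`;
* `fujiwaraRadius p = 2 · max {|a₀/(2aₙ)|^{1/n}, |a₁/aₙ|^{1/(n−1)}, …, |a_{n−1}/aₙ|}` — Fujiwara's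
  bound (1916) as displayed in Batra 2016, i.e. Theorem 6.4j with the weights
  `2⁻¹, …, 2^{−(n−1)}, 2^{−(n−1)}` of total mass exactly `1`: `nnnorm_le_fujiwaraRadius`,
  `fujiwaraRadius_le_inclusionRadius`;
* `norm_le_goldenRatio_mul` — for a *centred* polynomial (`a_{n−1} = 0`) with
  `|a_{n−m}| ≤ |aₙ| L^m` (`m ≥ 2`) every zero has `|w| ≤ φ L`, `φ = (1 + √5)/2` (the upper half of
  van der Sluis' theorem, Petković 2008 Thm 1.2), i.e. Theorem 6.4j with weights `0, φ⁻², φ⁻³, …`;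
* `le_norm_of_coeff_mul_pow_le` — **Lemma 6.4a** at the origin (weights; if
  `|a_m| ρ^m ≤ λ_m |a₀|` then every zero has `|w| ≥ ρ`), its proper version
  `lt_norm_of_coeff_mul_pow_le` (`Σ λ_m < 1`), **Theorem 6.4b** `lt_nnnorm_of_le_half_rpow`
  (`ρ ≤ ½ min |a₀/a_m|^{1/m}` ⟹ `|w| > ρ`), **Theorem 6.4d** (Cauchy) `le_norm_of_sum_mul_pow_le`,
  and the general-centre form `le_norm_sub_of_taylor_coeff_mul_pow_le` through Mathlib's
  `Polynomial.taylor` (`b_m = (taylor z₀ p).coeff m = p^{(m)}(z₀)/m!`, Henrici (6.4-2)).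

Relation to the tree. `Literature.Analysis.Complex.PelletTheorem` proves, over `ℂ` and by
Rouché / winding numbers, Pellet's root-COUNTING test; its extreme cases `pellet_natDegree`
(`Σ_{k<n} ‖b_k‖ rᵏ < ‖aₙ‖ rⁿ` ⟹ all roots in the OPEN disc) and `pellet_zero` (exclusion) are the
strict, complex, counted versions of the two Cauchy certificates below (`norm_le_of_sum_le`,
`le_norm_of_sum_mul_pow_le`). The present file is the elementary normed-field layer WITHOUT
counting: non-strict certificates (closed discs), Henrici's weighted form (Thm 6.4j / Lemma 6.4a)
and the closed-form radii (Cor 6.4k, Fujiwara, Thm 6.4b, van der Sluis' `φ L`), none of which is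
in that file; Mathlib's `Polynomial.cauchyBound` is the inhomogeneous bound `1 + max |aᵢ/aₙ|` and
`Literature.Analysis.Complex.AbhyankarJungAnalytic.norm_root_le` the bound `max 1 (Σ ‖c_k‖)` for
monic `p`.

Conventions / faithful typing. `K` is any normed field (Henrici: `ℂ`); `n = p.natDegree`,
`aᵢ = p.coeff i`, `aₙ = p.leadingCoeff`; the hypothesis `p ≠ 0` (resp. `a₀ ≠ 0`) is necessary —
the zero polynomial has every `z` as a root. Henrici normalises `aₙ = 1`; we keep `|aₙ|`
explicit. The "r-forms" carry no real powers; the closed forms live in `ℝ≥0` with `NNReal.rpow`,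
like Mathlib's `Polynomial.cauchyBound` (which is the different bound `1 + max |aᵢ/aₙ|`, neither
homogeneous nor comparable with `inclusionRadius`). For `n = 0` the closed forms are junk
(`inclusionRadius (C a) = 0`, `fujiwaraRadius (C a) = 2`) and the theorems are vacuous. The
counting refinements of §6.4.II/IV (discs containing at least `m` zeros: Thm 6.4e, Cor 6.4f/6.4g,
Thms 6.4m/6.4n) need the factorisation over `ℂ` and are not formalised here; the lower half
`√(2/n) L ≤ max |w|` of van der Sluis' theorem is not formalised either.

References.
* [Henrici1974] P. Henrici, Applied and Computational Complex Analysis, Vol. 1, Wiley 1974, §6.4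
  "Disks containing a specified number of zeros": Lemma 6.4a, Thm 6.4b, Thm 6.4d (§6.4.I),
  Thm 6.4j, Cor 6.4k (p. 457), Thm 6.4l (p. 458) (§6.4.III) (READ, galaxy panama:357169480335418;
  §III takes `aₙ = 1`, `a₀ ≠ 0`).
* [Petkovic2008] M. Petković, Point Estimation of Root Finding Methods, LNM 1933, Springer 2008,
  §1.2, Thm 1.1, (1.58), the annulus remark, Thm 1.2 (READ, galaxy panama:220452081369127).
* [Batra2016] P. Batra, On the quality of some root-bounds, MACIS 2015, LNCS 9582 (2016) 591–595,
  p. 592 (Fujiwara's bound `F(p)`, `μ(p) ≤ F(p)`) (READ, held corpus).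
-/

noncomputable section

open Polynomial Finset NNReal Metric

namespace Literature.Algebra.Polynomial.InclusionRadius

variable {K : Type*} [NormedField K]

/-! ### Reindexing, weights, and the two triangle-inequality estimates -/

/-- `Σ_{i<n} f(i+1) = Σ_{m=1}^{n} f(m)`. [folklore] -/
private theorem sum_range_succ_eq_sum_Icc {M : Type*} [AddCommMonoid M] (f : ℕ → M) (n : ℕ) :
    ∑ i ∈ range n, f (i + 1) = ∑ m ∈ Icc 1 n, f m := by
  refine sum_nbij' (· + 1) (· - 1) ?_ ?_ ?_ ?_ ?_
  · intro a ha; simp only [mem_range, mem_Icc] at ha ⊢; omega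
  · intro a ha; simp only [mem_range, mem_Icc] at ha ⊢; omega
  · intro a ha; simp only [mem_range] at ha; omega
  · intro a ha; simp only [mem_Icc] at ha; omega
  · intro a _; rfl

/-- `Σ_{i<n} f(n−i) = Σ_{m=1}^{n} f(m)` (coefficient index `i` versus Henrici's `m = n − i`).
[folklore] -/
private theorem sum_range_reflect_eq_sum_Icc {M : Type*} [AddCommMonoid M] (f : ℕ → M) (n : ℕ) :
    ∑ i ∈ range n, f (n - i) = ∑ m ∈ Icc 1 n, f m := by
  refine sum_nbij' (n - ·) (n - ·) ?_ ?_ ?_ ?_ ?_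
  · intro a ha; simp only [mem_range, mem_Icc] at ha ⊢; omega
  · intro a ha; simp only [mem_range, mem_Icc] at ha ⊢; omega
  · intro a ha; simp only [mem_range] at ha; omega
  · intro a ha; simp only [mem_Icc] at ha; omega
  · intro a _; rfl

/-- The geometric weights of Cor 6.4k / Thm 6.4b: `Σ_{m=1}^{n} 2^{−m} = 1 − 2^{−n}`. [folklore] -/
private theorem sum_Icc_half_pow (n : ℕ) : ∑ m ∈ Icc 1 n, (2⁻¹ : ℝ) ^ m = 1 - 2⁻¹ ^ n := by
  induction n with
  | zero => simp
  | succ n ih => rw [sum_Icc_succ_top (by omega), ih, pow_succ]; ring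

/-- Rescaling a coefficient bound by geometric weights: `t^{−m} c (t x)^m = c x^m`. [folklore] -/
private theorem inv_pow_mul_mul_pow {t : ℝ} (ht : t ≠ 0) (c x : ℝ) (m : ℕ) :
    t⁻¹ ^ m * c * (t * x) ^ m = c * x ^ m := by
  calc t⁻¹ ^ m * c * (t * x) ^ m = (t⁻¹ * t) ^ m * (c * x ^ m) := by ring
    _ = c * x ^ m := by rw [inv_mul_cancel₀ ht, one_pow, one_mul]

/-- `‖p(z) − aₙ zⁿ‖ ≤ Σ_{i<n} ‖aᵢ‖ ‖z‖ⁱ`. [folklore] -/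
private theorem norm_eval_sub_leadingCoeff_mul_pow_le (p : K[X]) (z : K) :
    ‖p.eval z - p.leadingCoeff * z ^ p.natDegree‖ ≤
      ∑ i ∈ range p.natDegree, ‖p.coeff i‖ * ‖z‖ ^ i := by
  rw [eval_eq_sum_range, sum_range_succ, coeff_natDegree, add_sub_cancel_right]
  refine (norm_sum_le _ _).trans (le_of_eq (sum_congr rfl fun i _ => ?_))
  rw [norm_mul, norm_pow]

/-- `‖p(z) − a₀‖ ≤ Σ_{m=1}^{n} ‖a_m‖ ‖z‖^m`. [folklore] -/
private theorem norm_eval_sub_coeff_zero_le (p : K[X]) (z : K) :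
    ‖p.eval z - p.coeff 0‖ ≤ ∑ m ∈ Icc 1 p.natDegree, ‖p.coeff m‖ * ‖z‖ ^ m := by
  rw [eval_eq_sum_range, sum_range_succ', pow_zero, mul_one, add_sub_cancel_right,
    ← sum_range_succ_eq_sum_Icc (fun m => ‖p.coeff m‖ * ‖z‖ ^ m)]
  refine (norm_sum_le _ _).trans (le_of_eq (sum_congr rfl fun i _ => ?_))
  rw [norm_mul, norm_pow]

/-- A polynomial `p ≠ 0` with a root has positive degree (the case `n = 0` below is vacuous).
[folklore] -/
private theorem natDegree_pos_of_isRoot {p : K[X]} (hp : p ≠ 0) {z : K} (hz : p.IsRoot z) :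
    0 < p.natDegree :=
  natDegree_pos_iff_degree_pos.mpr (degree_pos_of_root hp hz)

/-! ### III. Discs containing all zeros (inclusion radii) -/

/-- **Henrici, Theorem 6.4j** (inclusion radius with weights; Petković 2008 Thm 1.1), certificate
form. Let `λ_m ≥ 0` with `Σ_{m=1}^{n} λ_m ≤ 1` and `σ ≥ 0`. If `|a_{n−m}| ≤ λ_m |aₙ| σ^m` for
`m = 1, …, n`, then every zero `w` of `p ≠ 0` satisfies `|w| ≤ σ`. (Henrici:
`σ := max_m λ_m^{−1/m} |a_{n−m}/aₙ|^{1/m}` is the least `σ` satisfying the hypotheses when all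
`λ_m > 0`.) Proof: for `|z| > σ`,
`Σ_{i<n} |aᵢ||z|ⁱ ≤ Σ_m λ_m |aₙ| σ^m |z|^{n−m} ≤ (Σ_m λ_m) |aₙ| σ |z|^{n−1} < |aₙ zⁿ|`.
[cite: Henrici1974, §6.4 Thm 6.4j (p. 457)] [cite: Petkovic2008, §1.2 Thm 1.1] -/
theorem norm_le_of_coeff_le {p : K[X]} (hp : p ≠ 0) {w : ℕ → ℝ} (hw : ∀ m, 0 ≤ w m)
    (hsum : ∑ m ∈ Icc 1 p.natDegree, w m ≤ 1) {σ : ℝ} (hσ : 0 ≤ σ)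
    (hcoeff : ∀ m ∈ Icc 1 p.natDegree,
      ‖p.coeff (p.natDegree - m)‖ ≤ w m * ‖p.leadingCoeff‖ * σ ^ m)
    {z : K} (hz : p.IsRoot z) : ‖z‖ ≤ σ := by
  have hn := natDegree_pos_of_isRoot hp hz
  by_contra! hlt
  have hz0 : 0 < ‖z‖ := hσ.trans_lt hlt
  have hlc : 0 < ‖p.leadingCoeff‖ := norm_pos_iff.2 (leadingCoeff_ne_zero.2 hp)
  have hC : 0 ≤ ‖p.leadingCoeff‖ * σ * ‖z‖ ^ (p.natDegree - 1) :=
    mul_nonneg (mul_nonneg hlc.le hσ) (pow_nonneg hz0.le _)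
  have htail : ∑ i ∈ range p.natDegree, ‖p.coeff i‖ * ‖z‖ ^ i ≤
      ‖p.leadingCoeff‖ * σ * ‖z‖ ^ (p.natDegree - 1) := by
    calc ∑ i ∈ range p.natDegree, ‖p.coeff i‖ * ‖z‖ ^ i
        ≤ ∑ i ∈ range p.natDegree,
            w (p.natDegree - i) * (‖p.leadingCoeff‖ * σ * ‖z‖ ^ (p.natDegree - 1)) := by
          refine sum_le_sum fun i hi => ?_
          rw [mem_range] at hi
          have hc := hcoeff (p.natDegree - i) (by simp only [mem_Icc]; omega)
          rw [Nat.sub_sub_self hi.le] at hc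
          have hpow : σ ^ (p.natDegree - i) * ‖z‖ ^ i ≤ σ * ‖z‖ ^ (p.natDegree - 1) := by
            have h1 : σ ^ (p.natDegree - i) = σ * σ ^ (p.natDegree - i - 1) := by
              rw [← pow_succ', Nat.sub_add_cancel (by omega)]
            have h2 : ‖z‖ ^ (p.natDegree - 1) = ‖z‖ ^ (p.natDegree - i - 1) * ‖z‖ ^ i := by
              rw [← pow_add]; congr 1; omega
            rw [h1, h2, mul_assoc]
            exact mul_le_mul_of_nonneg_left (mul_le_mul_of_nonneg_right
              (pow_le_pow_left₀ hσ hlt.le _) (pow_nonneg hz0.le _)) hσ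
          calc ‖p.coeff i‖ * ‖z‖ ^ i
              ≤ w (p.natDegree - i) * ‖p.leadingCoeff‖ * σ ^ (p.natDegree - i) * ‖z‖ ^ i :=
                mul_le_mul_of_nonneg_right hc (pow_nonneg hz0.le _)
            _ = w (p.natDegree - i) * ‖p.leadingCoeff‖ * (σ ^ (p.natDegree - i) * ‖z‖ ^ i) := by
                ring
            _ ≤ w (p.natDegree - i) * ‖p.leadingCoeff‖ * (σ * ‖z‖ ^ (p.natDegree - 1)) :=
                mul_le_mul_of_nonneg_left hpow (mul_nonneg (hw _) hlc.le)
            _ = w (p.natDegree - i) * (‖p.leadingCoeff‖ * σ * ‖z‖ ^ (p.natDegree - 1)) := by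
                ring
      _ = (∑ i ∈ range p.natDegree, w (p.natDegree - i)) *
            (‖p.leadingCoeff‖ * σ * ‖z‖ ^ (p.natDegree - 1)) := by rw [sum_mul]
      _ ≤ 1 * (‖p.leadingCoeff‖ * σ * ‖z‖ ^ (p.natDegree - 1)) :=
          mul_le_mul_of_nonneg_right (by rw [sum_range_reflect_eq_sum_Icc]; exact hsum) hC
      _ = ‖p.leadingCoeff‖ * σ * ‖z‖ ^ (p.natDegree - 1) := one_mul _
  have hlead : ‖p.leadingCoeff‖ * σ * ‖z‖ ^ (p.natDegree - 1) <
      ‖p.leadingCoeff * z ^ p.natDegree‖ := by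
    rw [norm_mul, norm_pow]
    calc ‖p.leadingCoeff‖ * σ * ‖z‖ ^ (p.natDegree - 1)
        < ‖p.leadingCoeff‖ * ‖z‖ * ‖z‖ ^ (p.natDegree - 1) :=
          mul_lt_mul_of_pos_right (mul_lt_mul_of_pos_left hlt hlc) (pow_pos hz0 _)
      _ = ‖p.leadingCoeff‖ * ‖z‖ ^ p.natDegree := by
          rw [mul_assoc, ← pow_succ', Nat.sub_add_cancel hn]
  have key := norm_eval_sub_leadingCoeff_mul_pow_le p z
  rw [hz.eq_zero, zero_sub, norm_neg] at key
  linarith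

/-- **Henrici, Theorem 6.4j, proper form.** With `Σ_{m=1}^{n} λ_m < 1` and `σ > 0` the conclusion
is strict: every zero satisfies `|w| < σ` (a *proper* inclusion radius). (`σ > 0` is necessary:
`p = Xⁿ`.) [cite: Henrici1974, §6.4 Thm 6.4j (p. 457), bracketed version] -/
theorem norm_lt_of_coeff_le {p : K[X]} (hp : p ≠ 0) {w : ℕ → ℝ} (hw : ∀ m, 0 ≤ w m)
    (hsum : ∑ m ∈ Icc 1 p.natDegree, w m < 1) {σ : ℝ} (hσ : 0 < σ)
    (hcoeff : ∀ m ∈ Icc 1 p.natDegree,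
      ‖p.coeff (p.natDegree - m)‖ ≤ w m * ‖p.leadingCoeff‖ * σ ^ m)
    {z : K} (hz : p.IsRoot z) : ‖z‖ < σ := by
  by_contra! hle
  have hz0 : 0 < ‖z‖ := hσ.trans_le hle
  have hlc : 0 < ‖p.leadingCoeff‖ := norm_pos_iff.2 (leadingCoeff_ne_zero.2 hp)
  have hC : 0 < ‖p.leadingCoeff‖ * ‖z‖ ^ p.natDegree := mul_pos hlc (pow_pos hz0 _)
  have htail : ∑ i ∈ range p.natDegree, ‖p.coeff i‖ * ‖z‖ ^ i ≤
      (∑ m ∈ Icc 1 p.natDegree, w m) * (‖p.leadingCoeff‖ * ‖z‖ ^ p.natDegree) := by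
    rw [← sum_range_reflect_eq_sum_Icc, sum_mul]
    refine sum_le_sum fun i hi => ?_
    rw [mem_range] at hi
    have hc := hcoeff (p.natDegree - i) (by simp only [mem_Icc]; omega)
    rw [Nat.sub_sub_self hi.le] at hc
    have hpow : σ ^ (p.natDegree - i) * ‖z‖ ^ i ≤ ‖z‖ ^ p.natDegree := by
      calc σ ^ (p.natDegree - i) * ‖z‖ ^ i ≤ ‖z‖ ^ (p.natDegree - i) * ‖z‖ ^ i :=
            mul_le_mul_of_nonneg_right (pow_le_pow_left₀ hσ.le hle _) (pow_nonneg hz0.le _)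
        _ = ‖z‖ ^ p.natDegree := by rw [← pow_add, Nat.sub_add_cancel hi.le]
    calc ‖p.coeff i‖ * ‖z‖ ^ i
        ≤ w (p.natDegree - i) * ‖p.leadingCoeff‖ * σ ^ (p.natDegree - i) * ‖z‖ ^ i :=
          mul_le_mul_of_nonneg_right hc (pow_nonneg hz0.le _)
      _ = w (p.natDegree - i) * ‖p.leadingCoeff‖ * (σ ^ (p.natDegree - i) * ‖z‖ ^ i) := by ring
      _ ≤ w (p.natDegree - i) * ‖p.leadingCoeff‖ * ‖z‖ ^ p.natDegree :=
          mul_le_mul_of_nonneg_left hpow (mul_nonneg (hw _) hlc.le)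
      _ = w (p.natDegree - i) * (‖p.leadingCoeff‖ * ‖z‖ ^ p.natDegree) := by ring
  have hlead : (∑ m ∈ Icc 1 p.natDegree, w m) * (‖p.leadingCoeff‖ * ‖z‖ ^ p.natDegree) <
      ‖p.leadingCoeff * z ^ p.natDegree‖ := by
    rw [norm_mul, norm_pow]
    calc (∑ m ∈ Icc 1 p.natDegree, w m) * (‖p.leadingCoeff‖ * ‖z‖ ^ p.natDegree)
        < 1 * (‖p.leadingCoeff‖ * ‖z‖ ^ p.natDegree) := mul_lt_mul_of_pos_right hsum hC
      _ = ‖p.leadingCoeff‖ * ‖z‖ ^ p.natDegree := one_mul _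
  have key := norm_eval_sub_leadingCoeff_mul_pow_le p z
  rw [hz.eq_zero, zero_sub, norm_neg] at key
  linarith

/-- **Henrici, Theorem 6.4l** (Cauchy's inclusion radius), certificate form: if `σ > 0` and
`Σ_{i<n} |aᵢ| σⁱ ≤ |aₙ| σⁿ`, then every zero of `p ≠ 0` has `|w| ≤ σ`. (Cauchy's radius is the
unique positive root of `|aₙ| σⁿ = Σ_{i<n} |aᵢ| σⁱ`, the least such `σ`; `σ > 0` is necessary:
for `p = X² − X` the inequality holds at `σ = 0`.) Theorem 6.4j with
`λ_m := |a_{n−m}| σ^{n−m} / (|aₙ| σⁿ)`. [cite: Henrici1974, §6.4 Thm 6.4l (p. 458)] -/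
theorem norm_le_of_sum_le {p : K[X]} (hp : p ≠ 0) {σ : ℝ} (hσ : 0 < σ)
    (h : ∑ i ∈ range p.natDegree, ‖p.coeff i‖ * σ ^ i ≤ ‖p.leadingCoeff‖ * σ ^ p.natDegree)
    {z : K} (hz : p.IsRoot z) : ‖z‖ ≤ σ := by
  have hlc : 0 < ‖p.leadingCoeff‖ := norm_pos_iff.2 (leadingCoeff_ne_zero.2 hp)
  have hD : 0 < ‖p.leadingCoeff‖ * σ ^ p.natDegree := mul_pos hlc (pow_pos hσ _)
  refine norm_le_of_coeff_le hp
    (w := fun m => ‖p.coeff (p.natDegree - m)‖ * σ ^ (p.natDegree - m) /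
      (‖p.leadingCoeff‖ * σ ^ p.natDegree))
    (fun m => by positivity) ?_ hσ.le ?_ hz
  · rw [← sum_range_reflect_eq_sum_Icc (fun m => ‖p.coeff (p.natDegree - m)‖ *
      σ ^ (p.natDegree - m) / (‖p.leadingCoeff‖ * σ ^ p.natDegree)), ← sum_div, div_le_one hD]
    refine le_trans (le_of_eq (sum_congr rfl fun i hi => ?_)) h
    rw [mem_range] at hi
    rw [Nat.sub_sub_self hi.le]
  · intro m hm
    rw [mem_Icc] at hm
    have hσn : σ ^ p.natDegree = σ ^ (p.natDegree - m) * σ ^ m := by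
      rw [← pow_add, Nat.sub_add_cancel hm.2]
    rw [div_mul_eq_mul_div, div_mul_eq_mul_div, le_div_iff₀ hD, hσn]
    exact le_of_eq (by ring)

/-- **Henrici, Corollary 6.4k** — the inclusion radius `2 · max_{1≤m≤n} |a_{n−m}/aₙ|^{1/m}`
(Theorem 6.4j with `λ_m = 2^{−m}`), written over the coefficient index `i = n − m`; also
Petković 2008 (1.58) (there attributed to Dekker and Knuth) and Batra's `FM(p)`.
In `ℝ≥0` with `NNReal.rpow`, like Mathlib's `Polynomial.cauchyBound`.
[cite: Henrici1974, §6.4 Cor 6.4k (p. 457)] -/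
def inclusionRadius (p : K[X]) : ℝ≥0 :=
  2 * (range p.natDegree).sup fun i =>
    (‖p.coeff i‖₊ / ‖p.leadingCoeff‖₊) ^ ((p.natDegree - i : ℕ) : ℝ)⁻¹

/-- From `(|aᵢ|/|aₙ|)^{1/(n−i)} ≤ S` to the coefficient inequality `|aᵢ| ≤ |aₙ| S^{n−i}`.
[folklore] -/
private theorem norm_coeff_le_of_rpow_le {p : K[X]} (hp : p ≠ 0) {i : ℕ} (hi : i < p.natDegree)
    {S : ℝ≥0} (hS : (‖p.coeff i‖₊ / ‖p.leadingCoeff‖₊) ^ ((p.natDegree - i : ℕ) : ℝ)⁻¹ ≤ S) :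
    ‖p.coeff i‖ ≤ ‖p.leadingCoeff‖ * (S : ℝ) ^ (p.natDegree - i) := by
  have hlc : 0 < ‖p.leadingCoeff‖₊ := nnnorm_pos.2 (leadingCoeff_ne_zero.2 hp)
  have hk : (0 : ℝ) < ((p.natDegree - i : ℕ) : ℝ) := by exact_mod_cast Nat.sub_pos_of_lt hi
  rw [NNReal.rpow_inv_le_iff hk, NNReal.rpow_natCast, div_le_iff₀ hlc] at hS
  have h := NNReal.coe_le_coe.2 hS
  push_cast at h
  linarith

/-- **Henrici, Corollary 6.4k / Petković 2008 (1.58)**: every zero `w` of `p ≠ 0` satisfies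
`|w| ≤ 2 · max_{1≤m≤n} |a_{n−m}/aₙ|^{1/m}`.
[cite: Henrici1974, §6.4 Cor 6.4k (p. 457)] [cite: Petkovic2008, §1.2 eq. (1.58)] -/
theorem nnnorm_le_inclusionRadius {p : K[X]} (hp : p ≠ 0) {z : K} (hz : p.IsRoot z) :
    ‖z‖₊ ≤ inclusionRadius p := by
  rw [← NNReal.coe_le_coe, coe_nnnorm]
  unfold inclusionRadius
  push_cast
  refine norm_le_of_coeff_le hp (w := fun m => (2⁻¹ : ℝ) ^ m) (fun m => by positivity) ?_
    (by positivity) ?_ hz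
  · rw [sum_Icc_half_pow]
    linarith [pow_nonneg (by norm_num : (0 : ℝ) ≤ 2⁻¹) p.natDegree]
  · intro m hm
    rw [mem_Icc] at hm
    have hi : p.natDegree - m < p.natDegree := by omega
    have hle : (‖p.coeff (p.natDegree - m)‖₊ / ‖p.leadingCoeff‖₊) ^
        ((p.natDegree - (p.natDegree - m) : ℕ) : ℝ)⁻¹ ≤ (range p.natDegree).sup fun i =>
          (‖p.coeff i‖₊ / ‖p.leadingCoeff‖₊) ^ ((p.natDegree - i : ℕ) : ℝ)⁻¹ :=
      le_sup (f := fun i => (‖p.coeff i‖₊ / ‖p.leadingCoeff‖₊) ^ ((p.natDegree - i : ℕ) : ℝ)⁻¹)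
        (mem_range.2 hi)
    have h := norm_coeff_le_of_rpow_le hp hi hle
    rw [Nat.sub_sub_self hm.2] at h
    rw [inv_pow_mul_mul_pow two_ne_zero]
    exact h

/-- Set form of Corollary 6.4k: the zero set lies in the closed disc of radius `inclusionRadius p`
about the origin. [cite: Henrici1974, §6.4 Cor 6.4k (p. 457)] -/
theorem setOf_isRoot_subset_closedBall {p : K[X]} (hp : p ≠ 0) :
    {z : K | p.IsRoot z} ⊆ closedBall 0 (inclusionRadius p) := fun z hz => by
  rw [mem_closedBall, dist_zero_right, ← coe_nnnorm]
  exact NNReal.coe_le_coe.2 (nnnorm_le_inclusionRadius hp hz)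

/-- **Henrici, Corollary 6.4k as printed (OPEN disc).** If moreover `a₀ ≠ 0` then the inequality
is strict, `|w| < inclusionRadius p`, because `Σ 2^{−m} = 1 − 2^{−n} < 1` (Theorem 6.4j, proper
form). (`a₀ ≠ 0` is necessary: `p = Xⁿ` has the zero `0` and radius `0`.)
[cite: Henrici1974, §6.4 Cor 6.4k (p. 457)] -/
theorem nnnorm_lt_inclusionRadius {p : K[X]} (h0 : p.coeff 0 ≠ 0) {z : K} (hz : p.IsRoot z) :
    ‖z‖₊ < inclusionRadius p := by
  have hp : p ≠ 0 := fun h => h0 (by rw [h, coeff_zero])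
  have hn := natDegree_pos_of_isRoot hp hz
  have hlc : 0 < ‖p.leadingCoeff‖₊ := nnnorm_pos.2 (leadingCoeff_ne_zero.2 hp)
  have hS0 : 0 < (range p.natDegree).sup fun i =>
      (‖p.coeff i‖₊ / ‖p.leadingCoeff‖₊) ^ ((p.natDegree - i : ℕ) : ℝ)⁻¹ := by
    have h0' : 0 < (‖p.coeff 0‖₊ / ‖p.leadingCoeff‖₊) ^ ((p.natDegree - 0 : ℕ) : ℝ)⁻¹ :=
      NNReal.rpow_pos (div_pos (nnnorm_pos.2 h0) hlc)
    exact h0'.trans_le (le_sup (f := fun i =>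
      (‖p.coeff i‖₊ / ‖p.leadingCoeff‖₊) ^ ((p.natDegree - i : ℕ) : ℝ)⁻¹) (mem_range.2 hn))
  rw [← NNReal.coe_lt_coe, coe_nnnorm]
  unfold inclusionRadius
  push_cast
  refine norm_lt_of_coeff_le hp (w := fun m => (2⁻¹ : ℝ) ^ m) (fun m => by positivity) ?_
    (mul_pos two_pos (NNReal.coe_pos.2 hS0)) ?_ hz
  · rw [sum_Icc_half_pow]
    linarith [pow_pos (by norm_num : (0 : ℝ) < 2⁻¹) p.natDegree]
  · intro m hm
    rw [mem_Icc] at hm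
    have hi : p.natDegree - m < p.natDegree := by omega
    have hle : (‖p.coeff (p.natDegree - m)‖₊ / ‖p.leadingCoeff‖₊) ^
        ((p.natDegree - (p.natDegree - m) : ℕ) : ℝ)⁻¹ ≤ (range p.natDegree).sup fun i =>
          (‖p.coeff i‖₊ / ‖p.leadingCoeff‖₊) ^ ((p.natDegree - i : ℕ) : ℝ)⁻¹ :=
      le_sup (f := fun i => (‖p.coeff i‖₊ / ‖p.leadingCoeff‖₊) ^ ((p.natDegree - i : ℕ) : ℝ)⁻¹)
        (mem_range.2 hi)
    have h := norm_coeff_le_of_rpow_le hp hi hle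
    rw [Nat.sub_sub_self hm.2] at h
    rw [inv_pow_mul_mul_pow two_ne_zero]
    exact h

/-- **Fujiwara's bound** (Fujiwara 1916; Batra 2016 p. 592):
`F(p) = 2 · max {|a₀/(2aₙ)|^{1/n}, max_{1≤i<n} |aᵢ/aₙ|^{1/(n−i)}}` — Theorem 6.4j with the weights
`2^{−1}, …, 2^{−(n−1)}, 2^{−(n−1)}` (total mass exactly `1`), improving the constant-term entry of
Corollary 6.4k by the factor `2^{−1/n}`. [cite: Henrici1974, §6.4 Thm 6.4j (p. 457)] -/
def fujiwaraRadius (p : K[X]) : ℝ≥0 :=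
  2 * max ((‖p.coeff 0‖₊ / (2 * ‖p.leadingCoeff‖₊)) ^ ((p.natDegree : ℕ) : ℝ)⁻¹)
    ((Ico 1 p.natDegree).sup fun i =>
      (‖p.coeff i‖₊ / ‖p.leadingCoeff‖₊) ^ ((p.natDegree - i : ℕ) : ℝ)⁻¹)

/-- **Fujiwara's bound**: every zero `w` of `p ≠ 0` satisfies `|w| ≤ F(p)`.
[cite: Henrici1974, §6.4 Thm 6.4j (p. 457)] -/
theorem nnnorm_le_fujiwaraRadius {p : K[X]} (hp : p ≠ 0) {z : K} (hz : p.IsRoot z) :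
    ‖z‖₊ ≤ fujiwaraRadius p := by
  have hn := natDegree_pos_of_isRoot hp hz
  have hlc : 0 < ‖p.leadingCoeff‖₊ := nnnorm_pos.2 (leadingCoeff_ne_zero.2 hp)
  rw [← NNReal.coe_le_coe, coe_nnnorm]
  unfold fujiwaraRadius
  -- abbreviate the max
  generalize hF : max ((‖p.coeff 0‖₊ / (2 * ‖p.leadingCoeff‖₊)) ^ ((p.natDegree : ℕ) : ℝ)⁻¹)
    ((Ico 1 p.natDegree).sup fun i =>
      (‖p.coeff i‖₊ / ‖p.leadingCoeff‖₊) ^ ((p.natDegree - i : ℕ) : ℝ)⁻¹) = F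
  have hA : (‖p.coeff 0‖₊ / (2 * ‖p.leadingCoeff‖₊)) ^ ((p.natDegree : ℕ) : ℝ)⁻¹ ≤ F :=
    hF ▸ le_max_left _ _
  have hB : ((Ico 1 p.natDegree).sup fun i =>
      (‖p.coeff i‖₊ / ‖p.leadingCoeff‖₊) ^ ((p.natDegree - i : ℕ) : ℝ)⁻¹) ≤ F :=
    hF ▸ le_max_right _ _
  push_cast
  refine norm_le_of_coeff_le hp
    (w := fun m => if m < p.natDegree then (2⁻¹ : ℝ) ^ m else 2 * 2⁻¹ ^ m)
    (fun m => by split_ifs <;> positivity) ?_ (by positivity) ?_ hz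
  · -- Σ_{m=1}^{n-1} 2⁻ᵐ + 2 · 2⁻ⁿ = 1
    have hw : ∀ m ∈ Icc 1 p.natDegree,
        (if m < p.natDegree then (2⁻¹ : ℝ) ^ m else 2 * 2⁻¹ ^ m) =
          2⁻¹ ^ m + if m = p.natDegree then 2⁻¹ ^ m else 0 := by
      intro m hm
      rw [mem_Icc] at hm
      split_ifs <;> first | omega | ring
    rw [sum_congr rfl hw, sum_add_distrib, sum_Icc_half_pow, sum_ite_eq',
      if_pos (mem_Icc.2 ⟨hn, le_rfl⟩)]
    linarith
  · intro m hm
    rw [mem_Icc] at hm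
    rcases lt_or_eq_of_le hm.2 with hlt | heq
    · -- m < n: coefficient index i = n - m ∈ Ico 1 n
      rw [if_pos hlt]
      have hi : p.natDegree - m < p.natDegree := by omega
      have hle : (‖p.coeff (p.natDegree - m)‖₊ / ‖p.leadingCoeff‖₊) ^
          ((p.natDegree - (p.natDegree - m) : ℕ) : ℝ)⁻¹ ≤ F :=
        le_trans (le_sup (f := fun i =>
          (‖p.coeff i‖₊ / ‖p.leadingCoeff‖₊) ^ ((p.natDegree - i : ℕ) : ℝ)⁻¹)
          (mem_Ico.2 ⟨by omega, hi⟩)) hB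
      have h := norm_coeff_le_of_rpow_le hp hi hle
      rw [Nat.sub_sub_self hm.2] at h
      rw [inv_pow_mul_mul_pow two_ne_zero]
      exact h
    · -- m = n: the constant term, weight 2 · 2⁻ⁿ = 2^{-(n-1)}
      rw [if_neg (by omega), heq, Nat.sub_self]
      have hk : (0 : ℝ) < ((p.natDegree : ℕ) : ℝ) := by exact_mod_cast hn
      have h2 : ‖p.coeff 0‖₊ / (2 * ‖p.leadingCoeff‖₊) ≤ F ^ p.natDegree := by
        have h := hA
        rwa [NNReal.rpow_inv_le_iff hk, NNReal.rpow_natCast] at h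
      rw [div_le_iff₀ (by positivity)] at h2
      have h3 := NNReal.coe_le_coe.2 h2
      push_cast at h3
      calc ‖p.coeff 0‖ ≤ (F : ℝ) ^ p.natDegree * (2 * ‖p.leadingCoeff‖) := h3
        _ = 2 * 2⁻¹ ^ p.natDegree * ‖p.leadingCoeff‖ * (2 * (F : ℝ)) ^ p.natDegree := by
            rw [show (2 : ℝ) * 2⁻¹ ^ p.natDegree * ‖p.leadingCoeff‖ * (2 * (F : ℝ)) ^ p.natDegree
                = 2⁻¹ ^ p.natDegree * (2 * ‖p.leadingCoeff‖) * (2 * (F : ℝ)) ^ p.natDegree by ring,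
              inv_pow_mul_mul_pow two_ne_zero, mul_comm]

/-- `F(p) ≤ 2 · max_m |a_{n−m}/aₙ|^{1/m}`: Fujiwara's radius refines Corollary 6.4k (`n ≥ 1`).
[cite: Henrici1974, §6.4 Cor 6.4k — comparison of the generic inclusion radius with Fujiwara's bound; the
inequality is an elementary remark (folklore)] -/
theorem fujiwaraRadius_le_inclusionRadius {p : K[X]} (hn : 0 < p.natDegree) :
    fujiwaraRadius p ≤ inclusionRadius p := by
  unfold fujiwaraRadius inclusionRadius
  refine mul_le_mul_of_nonneg_left (max_le ?_ ?_) (by norm_num)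
  · refine le_trans ?_ (le_sup (f := fun i =>
      (‖p.coeff i‖₊ / ‖p.leadingCoeff‖₊) ^ ((p.natDegree - i : ℕ) : ℝ)⁻¹) (mem_range.2 hn))
    rw [Nat.sub_zero]
    refine NNReal.rpow_le_rpow ?_ (by positivity)
    by_cases hlc : ‖p.leadingCoeff‖₊ = 0
    · simp [hlc]
    · exact div_le_div_of_nonneg_left bot_le (pos_iff_ne_zero.2 hlc)
        (le_mul_of_one_le_left bot_le one_le_two)
  · apply sup_mono
    rw [range_eq_Ico]
    exact Ico_subset_Ico_left (Nat.zero_le 1)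

/-- **Van der Sluis' upper bound** (Petković 2008 Thm 1.2, right half): for a *centred* polynomial
(`a_{n−1} = 0`, i.e. the centroid of the zeros is `0`) with `|a_{n−m}| ≤ |aₙ| L^m` for
`2 ≤ m ≤ n` (`L ≥ 0`; the least such `L` is `max_{m≥2} |a_{n−m}/aₙ|^{1/m}`), every zero satisfies
`|w| ≤ φ L`, `φ = (1 + √5)/2 < 1.62` — Theorem 6.4j with the weights `λ₁ = 0`, `λ_m = φ^{−m}`
(`m ≥ 2`), whose total mass is `< φ^{−2}/(1 − φ^{−1}) = 1`.
[cite: Petkovic2008, §1.2 Thm 1.2 (upper bound)] [cite: Henrici1974, §6.4 Thm 6.4j (p. 457)] -/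
theorem norm_le_goldenRatio_mul {p : K[X]} (hp : p ≠ 0) (hc : p.coeff (p.natDegree - 1) = 0)
    {L : ℝ} (hL : 0 ≤ L)
    (hcoeff : ∀ m ∈ Icc 2 p.natDegree, ‖p.coeff (p.natDegree - m)‖ ≤ ‖p.leadingCoeff‖ * L ^ m)
    {z : K} (hz : p.IsRoot z) : ‖z‖ ≤ Real.goldenRatio * L := by
  have hφ := Real.goldenRatio_pos
  have hinv : Real.goldenRatio⁻¹ = Real.goldenRatio - 1 := by
    rw [Real.inv_goldenRatio, ← Real.one_sub_goldenConj]; ring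
  have ht0 : 0 ≤ Real.goldenRatio⁻¹ := inv_nonneg.2 hφ.le
  have ht1 : Real.goldenRatio⁻¹ < 1 := by rw [hinv]; linarith [Real.goldenRatio_lt_two]
  have hkey : Real.goldenRatio⁻¹ ^ 2 = 1 - Real.goldenRatio⁻¹ := by
    rw [hinv]; linear_combination Real.goldenRatio_sq
  -- the weights φ^{-m}, m ≥ 2, have total mass ≤ 1
  have hsumφ : ∑ m ∈ Icc 2 p.natDegree, Real.goldenRatio⁻¹ ^ m ≤ 1 := by
    have hIcc : Icc 2 p.natDegree = Ico 2 (p.natDegree + 1) := by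
      ext m; simp only [mem_Icc, mem_Ico]; omega
    rw [hIcc]
    calc ∑ m ∈ Ico 2 (p.natDegree + 1), Real.goldenRatio⁻¹ ^ m
        ≤ Real.goldenRatio⁻¹ ^ 2 / (1 - Real.goldenRatio⁻¹) := geom_sum_Ico_le_of_lt_one ht0 ht1
      _ = 1 := by rw [hkey, div_self (sub_pos.2 ht1).ne']
  refine norm_le_of_coeff_le hp
    (w := fun m => if 2 ≤ m then Real.goldenRatio⁻¹ ^ m else 0)
    (fun m => by split_ifs <;> positivity) ?_ (by positivity) ?_ hz
  · rw [sum_ite, sum_const_zero, add_zero]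
    have hfilter : (Icc 1 p.natDegree).filter (fun m => 2 ≤ m) = Icc 2 p.natDegree := by
      ext m; simp only [mem_filter, mem_Icc]; omega
    rw [hfilter]
    exact hsumφ
  · intro m hm
    rw [mem_Icc] at hm
    split_ifs with h2
    · rw [inv_pow_mul_mul_pow hφ.ne']
      exact hcoeff m (mem_Icc.2 ⟨h2, hm.2⟩)
    · have hm1 : m = 1 := by omega
      rw [hm1, hc, norm_zero]
      positivity

/-! ### I. Discs free of zeros (exclusion radii) -/

/-- **Henrici, Lemma 6.4a** (at the origin), certificate form. Let `a₀ ≠ 0`, `Σ_{m=1}^{n} λ_m ≤ 1`,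
`ρ ≥ 0`, and `|a_m| ρ^m ≤ λ_m |a₀|` for `m = 1, …, n` (so `λ_m ≥ 0` automatically). Then every
zero `w` satisfies `|w| ≥ ρ`, i.e. the open disc `|z| < ρ` is free of zeros (Henrici:
`ρ := min_{a_m ≠ 0} λ_m^{1/m} |a₀/a_m|^{1/m}`). Proof: for `|z| < ρ`,
`Σ_m |a_m||z|^m ≤ (|z|/ρ) Σ_m λ_m |a₀| < |a₀|`. [cite: Henrici1974, §6.4 Lemma 6.4a] -/
theorem le_norm_of_coeff_mul_pow_le {p : K[X]} (h0 : p.coeff 0 ≠ 0) {w : ℕ → ℝ}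
    (hsum : ∑ m ∈ Icc 1 p.natDegree, w m ≤ 1) {ρ : ℝ} (hρ : 0 ≤ ρ)
    (hcoeff : ∀ m ∈ Icc 1 p.natDegree, ‖p.coeff m‖ * ρ ^ m ≤ w m * ‖p.coeff 0‖)
    {z : K} (hz : p.IsRoot z) : ρ ≤ ‖z‖ := by
  by_contra! hlt
  have ha0 : 0 < ‖p.coeff 0‖ := norm_pos_iff.2 h0
  have hρ0 : 0 < ρ := (norm_nonneg z).trans_lt hlt
  have htail : ρ * ∑ m ∈ Icc 1 p.natDegree, ‖p.coeff m‖ * ‖z‖ ^ m ≤ ‖p.coeff 0‖ * ‖z‖ := by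
    rw [mul_sum]
    calc ∑ m ∈ Icc 1 p.natDegree, ρ * (‖p.coeff m‖ * ‖z‖ ^ m)
        ≤ ∑ m ∈ Icc 1 p.natDegree, w m * (‖p.coeff 0‖ * ‖z‖) := by
          refine sum_le_sum fun m hm => ?_
          have hc := hcoeff m hm
          rw [mem_Icc] at hm
          have hzm : ‖z‖ ^ m = ‖z‖ ^ (m - 1) * ‖z‖ := by
            rw [← pow_succ, Nat.sub_add_cancel hm.1]
          have hρm : ρ ^ m = ρ * ρ ^ (m - 1) := by
            rw [← pow_succ', Nat.sub_add_cancel hm.1]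
          have h2 : ρ * ‖z‖ ^ (m - 1) ≤ ρ * ρ ^ (m - 1) :=
            mul_le_mul_of_nonneg_left (pow_le_pow_left₀ (norm_nonneg _) hlt.le _) hρ
          calc ρ * (‖p.coeff m‖ * ‖z‖ ^ m) = ‖p.coeff m‖ * (ρ * ‖z‖ ^ (m - 1)) * ‖z‖ := by
                rw [hzm]; ring
            _ ≤ ‖p.coeff m‖ * (ρ * ρ ^ (m - 1)) * ‖z‖ :=
                mul_le_mul_of_nonneg_right (mul_le_mul_of_nonneg_left h2 (norm_nonneg _))
                  (norm_nonneg _)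
            _ = ‖p.coeff m‖ * ρ ^ m * ‖z‖ := by rw [hρm]
            _ ≤ w m * ‖p.coeff 0‖ * ‖z‖ := mul_le_mul_of_nonneg_right hc (norm_nonneg _)
            _ = w m * (‖p.coeff 0‖ * ‖z‖) := mul_assoc _ _ _
      _ = (∑ m ∈ Icc 1 p.natDegree, w m) * (‖p.coeff 0‖ * ‖z‖) := by rw [sum_mul]
      _ ≤ 1 * (‖p.coeff 0‖ * ‖z‖) :=
          mul_le_mul_of_nonneg_right hsum (mul_nonneg ha0.le (norm_nonneg _))
      _ = ‖p.coeff 0‖ * ‖z‖ := one_mul _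
  have key := norm_eval_sub_coeff_zero_le p z
  rw [hz.eq_zero, zero_sub, norm_neg] at key
  have h1 : ρ * ‖p.coeff 0‖ ≤ ‖p.coeff 0‖ * ‖z‖ :=
    (mul_le_mul_of_nonneg_left key hρ0.le).trans htail
  have h2 : ‖p.coeff 0‖ * ‖z‖ < ‖p.coeff 0‖ * ρ := mul_lt_mul_of_pos_left hlt ha0
  linarith

/-- **Henrici, Lemma 6.4a, proper form**: with `Σ λ_m < 1` the closed disc `|z| ≤ ρ` is free of
zeros, `|w| > ρ` (no sign hypothesis on `ρ` is needed: for `ρ < 0` the conclusion is trivial). [cite: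
Henrici1974, §6.4 Lemma 6.4a] -/
theorem lt_norm_of_coeff_mul_pow_le {p : K[X]} (h0 : p.coeff 0 ≠ 0) {w : ℕ → ℝ}
    (hsum : ∑ m ∈ Icc 1 p.natDegree, w m < 1) {ρ : ℝ}
    (hcoeff : ∀ m ∈ Icc 1 p.natDegree, ‖p.coeff m‖ * ρ ^ m ≤ w m * ‖p.coeff 0‖)
    {z : K} (hz : p.IsRoot z) : ρ < ‖z‖ := by
  by_contra! hle
  have ha0 : 0 < ‖p.coeff 0‖ := norm_pos_iff.2 h0
  have htail : ∑ m ∈ Icc 1 p.natDegree, ‖p.coeff m‖ * ‖z‖ ^ m ≤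
      (∑ m ∈ Icc 1 p.natDegree, w m) * ‖p.coeff 0‖ := by
    rw [sum_mul]
    refine sum_le_sum fun m hm => ?_
    calc ‖p.coeff m‖ * ‖z‖ ^ m ≤ ‖p.coeff m‖ * ρ ^ m :=
          mul_le_mul_of_nonneg_left (pow_le_pow_left₀ (norm_nonneg _) hle _) (norm_nonneg _)
      _ ≤ w m * ‖p.coeff 0‖ := hcoeff m hm
  have key := norm_eval_sub_coeff_zero_le p z
  rw [hz.eq_zero, zero_sub, norm_neg] at key
  have h2 : (∑ m ∈ Icc 1 p.natDegree, w m) * ‖p.coeff 0‖ < 1 * ‖p.coeff 0‖ :=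
    mul_lt_mul_of_pos_right hsum ha0
  linarith

/-- **Henrici, Theorem 6.4b**: if `a₀ ≠ 0` and `ρ ≤ ½ |a₀/a_m|^{1/m}` for every `1 ≤ m ≤ n` with
`a_m ≠ 0` (i.e. `ρ ≤ ½ α(0)`, (6.4-4)), then the closed disc `|z| ≤ ρ` contains no zero of `p`:
`|w| > ρ` (Lemma 6.4a with `λ_m = 2^{−m}`, strict since `Σ 2^{−m} < 1`); Petković 2008's
zero-free disc `r = ½ min |a₀/a_k|^{1/k}` and the annulus `r ≤ |w| ≤ R`.
[cite: Henrici1974, §6.4 Thm 6.4b] [cite: Petkovic2008, §1.2 (annulus after (1.58))] -/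
theorem lt_nnnorm_of_le_half_rpow {p : K[X]} (h0 : p.coeff 0 ≠ 0) {ρ : ℝ≥0}
    (hρ : ∀ m ∈ Icc 1 p.natDegree, p.coeff m ≠ 0 →
      ρ ≤ 2⁻¹ * (‖p.coeff 0‖₊ / ‖p.coeff m‖₊) ^ ((m : ℕ) : ℝ)⁻¹)
    {z : K} (hz : p.IsRoot z) : ρ < ‖z‖₊ := by
  rw [← NNReal.coe_lt_coe, coe_nnnorm]
  refine lt_norm_of_coeff_mul_pow_le h0 (w := fun m => (2⁻¹ : ℝ) ^ m) ?_ ?_ hz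
  · rw [sum_Icc_half_pow]
    linarith [pow_pos (by norm_num : (0 : ℝ) < 2⁻¹) p.natDegree]
  · intro m hm
    by_cases hm0 : p.coeff m = 0
    · rw [hm0, norm_zero, zero_mul]; positivity
    have h := hρ m hm hm0
    have hmpos : (0 : ℝ) < ((m : ℕ) : ℝ) := by
      rw [mem_Icc] at hm
      exact_mod_cast hm.1
    have h2 : 2 * ρ ≤ (‖p.coeff 0‖₊ / ‖p.coeff m‖₊) ^ ((m : ℕ) : ℝ)⁻¹ := by
      calc 2 * ρ ≤ 2 * (2⁻¹ * (‖p.coeff 0‖₊ / ‖p.coeff m‖₊) ^ ((m : ℕ) : ℝ)⁻¹) :=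
            mul_le_mul_of_nonneg_left h (by norm_num)
        _ = (‖p.coeff 0‖₊ / ‖p.coeff m‖₊) ^ ((m : ℕ) : ℝ)⁻¹ := by
            rw [← mul_assoc, mul_inv_cancel₀ two_ne_zero, one_mul]
    rw [NNReal.le_rpow_inv_iff hmpos, NNReal.rpow_natCast, le_div_iff₀ (nnnorm_pos.2 hm0)] at h2
    have h3 := NNReal.coe_le_coe.2 h2
    push_cast at h3
    calc ‖p.coeff m‖ * (ρ : ℝ) ^ m = 2⁻¹ ^ m * ((2 * (ρ : ℝ)) ^ m * ‖p.coeff m‖) := by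
          rw [← inv_pow_mul_mul_pow two_ne_zero (‖p.coeff m‖) (ρ : ℝ) m]; ring
      _ ≤ 2⁻¹ ^ m * ‖p.coeff 0‖ := mul_le_mul_of_nonneg_left h3 (by positivity)

/-- **Henrici, Theorem 6.4d** (Cauchy), certificate form: if `a₀ ≠ 0`, `ρ ≥ 0` and
`Σ_{m=1}^{n} |a_m| ρ^m ≤ |a₀|`, then every zero satisfies `|w| ≥ ρ` (the exact zero-free radius
`ρ₁` is the positive root of `|a₀| = Σ |a_m| ρ^m`, (6.4-6)). Lemma 6.4a with
`λ_m := |a_m| ρ^m / |a₀|`. [cite: Henrici1974, §6.4 Thm 6.4d] -/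
theorem le_norm_of_sum_mul_pow_le {p : K[X]} (h0 : p.coeff 0 ≠ 0) {ρ : ℝ} (hρ : 0 ≤ ρ)
    (h : ∑ m ∈ Icc 1 p.natDegree, ‖p.coeff m‖ * ρ ^ m ≤ ‖p.coeff 0‖)
    {z : K} (hz : p.IsRoot z) : ρ ≤ ‖z‖ := by
  have ha0 : 0 < ‖p.coeff 0‖ := norm_pos_iff.2 h0
  refine le_norm_of_coeff_mul_pow_le h0 (w := fun m => ‖p.coeff m‖ * ρ ^ m / ‖p.coeff 0‖)
    ?_ hρ ?_ hz
  · rw [← sum_div, div_le_one ha0]; exact h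
  · intro m _
    rw [div_mul_cancel₀ _ ha0.ne']

/-- **Henrici, Lemma 6.4a about an arbitrary centre `z₀`.** With Henrici's Taylor coefficients
`b_m = p^{(m)}(z₀)/m! = (taylor z₀ p).coeff m` ((6.4-2); `b₀ = p(z₀) ≠ 0`): if
`|b_m| ρ^m ≤ λ_m |b₀|` (`Σ λ_m ≤ 1`) then every zero satisfies `|w − z₀| ≥ ρ`.
[cite: Henrici1974, §6.4 Lemma 6.4a] -/
theorem le_norm_sub_of_taylor_coeff_mul_pow_le {p : K[X]} {z₀ : K} (h0 : p.eval z₀ ≠ 0)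
    {w : ℕ → ℝ} (hsum : ∑ m ∈ Icc 1 p.natDegree, w m ≤ 1) {ρ : ℝ} (hρ : 0 ≤ ρ)
    (hcoeff : ∀ m ∈ Icc 1 p.natDegree, ‖(taylor z₀ p).coeff m‖ * ρ ^ m ≤ w m * ‖p.eval z₀‖)
    {z : K} (hz : p.IsRoot z) : ρ ≤ ‖z - z₀‖ := by
  have h0' : (taylor z₀ p).coeff 0 ≠ 0 := by rwa [taylor_coeff_zero]
  have hz' : (taylor z₀ p).IsRoot (z - z₀) := by
    rw [IsRoot.def, taylor_eval_sub]; exact hz.eq_zero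
  refine le_norm_of_coeff_mul_pow_le h0' (by rwa [natDegree_taylor]) hρ ?_ hz'
  intro m hm
  rw [natDegree_taylor] at hm
  rw [taylor_coeff_zero]
  exact hcoeff m hm

end Literature.Algebra.Polynomial.InclusionRadius
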